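import Mathlib
import Literature.NumberTheory.Automorphic.HilbertModularFormQExpansion
import Literature.NumberTheory.LFunctions.DedekindZetaThetaProofs
import Summits.Langlands.Langlands.Theorems.CapacityClassicalityHilbertIntegralOverconvergentIsCongruenceStubTotallyRealEmbeddings

/-!
# Hecke's theta inversion on the imaginary orthant (stub `stub_theta_inversion_imaginary` of line Sketch-ideate-r1-k1)

For a totally real number field `F` and `y = (y_σ)_σ ≫ 0` we prove
`Θ(i/(4y)) = |d_F|^{-1/2} ∏_σ √(2y_σ) · Θ'(iy)`, where `Θ(z) = ∑_{x ∈ 𝓞 F} e^{2πi S(x² z)}` and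
`Θ'(z) = ∑_{ξ ∈ 𝔡⁻¹} e^{2πi S(ξ² z)}`, `S(νz) = ∑_σ σ(ν) z_σ` (`HilbertModular.pairing`).
This is the tree's theta transformation formula for fractional ideals
`Literature.NumberTheory.LFunctions.NumberField.thetaIdeal_inv_holds` (Neukirch VII (3.6) with
(5.7): `θ_𝔞(i y'⁻¹) = √N(y') / (𝔑(𝔞) √|d_F|) · θ_{(𝔞𝔡)⁻¹}(i y')`) at `𝔞 = 𝓞 F = 1` and
`y' = 2y`, after re-indexing:
* infinite places `w` of the totally real `F` ↔ real embeddings `σ : F →+* ℝ`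
  (`tii_exists_embEquiv`; all places are real, `mult w = 1`, `|a|_w = |σ_w a|`), so that
  Neukirch's form `⟨a y', a⟩ = ∑_w e_w y'_w |a|_w²` is `∑_σ y'_σ σ(a)²` and `N(y') = ∏_σ y'_σ`;
* `↥(1 : FractionalIdeal) ≃ 𝓞 F` (`tii_exists_intEquivOne`) and
  `↥(FractionalIdeal.dual ℤ ℚ 1) ≃ {ν | Tr(ν a) ∈ ℤ ∀ a ∈ 𝓞 F}` (`tii_exists_dualEquiv`);
* at `z_σ = i/(4y_σ)` the summand `e^{2πi S(x² z)}` is `e^{-π ∑_σ σ(x)² (2y_σ)⁻¹}`, the theta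
  summand at height `(2y)⁻¹`, and at `z = iy` the dual summand is the theta summand at height `2y`.
Everything is real; the complex statement follows by casting (`Complex.ofReal_tsum`).
-/

set_option linter.dupNamespace false

noncomputable section

namespace Summit.Langlands.Langlands.Theorems.HilbertIntegralOverconvergentIsCongruence

open MeasureTheory Complex NumberField
open Literature.NumberTheory.Automorphic Literature.NumberTheory.Automorphic.HilbertModular
open Literature.NumberTheory.LFunctions.NumberField
open scoped MatrixGroups nonZeroDivisors

section Places

variable (F : Type) [Field F]

/-- For a totally real field, infinite places correspond to real embeddings: `w ↦ σ_w`, the real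
embedding of the (real) place `w` (inverse: `σ ↦` the place of `ℝ ∘ σ`), and `|σ_w a| = |a|_w`.
[folklore] -/
theorem tii_exists_embEquiv [NumberField.IsTotallyReal F] :
    ∃ e : InfinitePlace F ≃ (F →+* ℝ), ∀ (w : InfinitePlace F) (a : F), |e w a| = w a := by
  refine ⟨{ toFun := fun w ↦ InfinitePlace.embedding_of_isReal (IsTotallyReal.isReal w)
            invFun := fun σ ↦ InfinitePlace.mk (Complex.ofRealHom.comp σ)
            left_inv := fun w ↦ ?_
            right_inv := fun σ ↦ ?_ }, fun w a ↦ ?_⟩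
  · have h : Complex.ofRealHom.comp (InfinitePlace.embedding_of_isReal (IsTotallyReal.isReal w)) =
        InfinitePlace.embedding w :=
      RingHom.ext fun x ↦ InfinitePlace.embedding_of_isReal_apply _ x
    simp only [h, InfinitePlace.mk_embedding]
  · ext x
    apply Complex.ofReal_injective
    rw [InfinitePlace.embedding_of_isReal_apply,
      InfinitePlace.embedding_mk_eq_of_isReal (kD_isReal_ofRealHom_comp σ)]
    rfl
  · rw [← Real.norm_eq_abs]
    exact InfinitePlace.norm_embedding_of_isReal (IsTotallyReal.isReal w) a

/-- `↥(1 : FractionalIdeal) ≃ 𝓞 F` by `a ↦ a`. [folklore] -/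
theorem tii_exists_intEquivOne :
    ∃ E : 𝓞 F ≃ {a : F // a ∈ (1 : FractionalIdeal (𝓞 F)⁰ F)}, ∀ a : 𝓞 F, ((E a : F)) = a :=
  ⟨Equiv.ofBijective (fun a ↦ ⟨(a : F), FractionalIdeal.coe_mem_one _ a⟩)
    ⟨fun a b h ↦ by
      have h' := congrArg Subtype.val h
      exact RingOfIntegers.coe_injective h', fun x ↦ by
      obtain ⟨a, ha⟩ := (FractionalIdeal.mem_one_iff _).mp x.2
      exact ⟨a, Subtype.ext ha⟩⟩, fun _ ↦ rfl⟩

end Places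

section Reindex

variable (F : Type) [Field F] [NumberField F]

/-- Neukirch's form over a totally real field, indexed by real embeddings:
`⟨aY, a⟩ = ∑_σ Y_σ σ(a)²`. [folklore] -/
theorem tii_minkowskiQuadForm_eq [NumberField.IsTotallyReal F] (e : InfinitePlace F ≃ (F →+* ℝ))
    (he : ∀ (w : InfinitePlace F) (a : F), |e w a| = w a) (Y : InfinitePlace F → ℝ) (a : F) :
    minkowskiQuadForm F Y a = ∑ σ : F →+* ℝ, Y (e.symm σ) * (σ a) ^ 2 := by
  unfold minkowskiQuadForm
  refine Fintype.sum_equiv e _ _ fun w ↦ ?_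
  rw [IsTotallyReal.mult_eq, Nat.cast_one, one_mul, Equiv.symm_apply_apply, ← he, sq_abs]

/-- `N(Y) = ∏_σ Y_σ` over a totally real field. [folklore] -/
theorem tii_mixedNorm_eq [NumberField.IsTotallyReal F] (e : InfinitePlace F ≃ (F →+* ℝ))
    (Y : InfinitePlace F → ℝ) : mixedNorm F Y = ∏ σ : F →+* ℝ, Y (e.symm σ) := by
  unfold mixedNorm
  refine Fintype.prod_equiv e _ _ fun w ↦ ?_
  rw [IsTotallyReal.mult_eq, pow_one, Equiv.symm_apply_apply]

/-- Membership in the dual `𝔡⁻¹ = dual ℤ ℚ 1` of the unit ideal: `Tr(x a) ∈ ℤ` for all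
`a ∈ 𝓞 F`. [folklore] -/
theorem tii_mem_dual_one_iff (x : F) :
    x ∈ FractionalIdeal.dual ℤ ℚ (1 : FractionalIdeal (𝓞 F)⁰ F) ↔
      ∀ a : 𝓞 F, ∃ n : ℤ, Algebra.trace ℚ F (x * a) = n := by
  rw [FractionalIdeal.mem_dual (A := ℤ) (K := ℚ) (I := (1 : FractionalIdeal (𝓞 F)⁰ F))
    one_ne_zero]
  constructor
  · intro h a
    obtain ⟨n, hn⟩ :=
      RingHom.mem_range.mp (h (a : F) ((FractionalIdeal.mem_one_iff _).mpr ⟨a, rfl⟩))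
    exact ⟨n, by rw [← Algebra.traceForm_apply, ← hn, eq_intCast]⟩
  · rintro h a ha
    obtain ⟨a', rfl⟩ := (FractionalIdeal.mem_one_iff _).mp ha
    obtain ⟨n, hn⟩ := h a'
    exact RingHom.mem_range.mpr ⟨n, by rw [Algebra.traceForm_apply, eq_intCast, ← hn]⟩

/-- `↥(dual ℤ ℚ 1) ≃ {ν | Tr(ν a) ∈ ℤ ∀ a ∈ 𝓞 F}` (the identity on `F`). [folklore] -/
theorem tii_exists_dualEquiv :
    ∃ E : {x : F // x ∈ FractionalIdeal.dual ℤ ℚ (1 : FractionalIdeal (𝓞 F)⁰ F)} ≃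
      {ν : F | ∀ a : 𝓞 F, ∃ n : ℤ, Algebra.trace ℚ F (ν * a) = n}, ∀ x, ((E x : F)) = x :=
  ⟨Equiv.subtypeEquivRight fun x ↦ tii_mem_dual_one_iff F x, fun _ ↦ rfl⟩

end Reindex

section Summands

variable {F : Type} [Field F] [NumberField F]

/-- `e^{2πi S(ν · it)} = e^{-2π ∑_σ σ(ν) t_σ}` (real). [folklore] -/
theorem tii_cexp_pairing_mul_I (ν : F) (t : (F →+* ℝ) → ℝ) :
    cexp (2 * Real.pi * I * pairing ν (fun σ ↦ ((t σ : ℝ) : ℂ) * I)) =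
      ((Real.exp (-(2 * Real.pi * ∑ σ : F →+* ℝ, σ ν * t σ)) : ℝ) : ℂ) := by
  have h : pairing ν (fun σ ↦ ((t σ : ℝ) : ℂ) * I) = ((∑ σ : F →+* ℝ, σ ν * t σ : ℝ) : ℂ) * I := by
    simp only [pairing]
    push_cast
    rw [Finset.sum_mul]
    exact Finset.sum_congr rfl fun σ _ ↦ by ring
  rw [h, Complex.ofReal_exp]
  congr 1
  push_cast
  ring_nf
  rw [I_sq]
  ring

end Summands

section Sides

variable (F : Type) [Field F] [NumberField F] [NumberField.IsTotallyReal F]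
  (e : InfinitePlace F ≃ (F →+* ℝ)) (he : ∀ (w : InfinitePlace F) (a : F), |e w a| = w a)

include he

/-- At `z_σ = i/(4y_σ)`: `e^{2πi S(x² z)} = e^{-π ∑_σ σ(x)² (2y_σ)⁻¹}`, the theta summand at
height `(2y)⁻¹` (place-indexed height `Y_w = 2 y_{σ_w}`). [folklore] -/
theorem tii_summand_lhs (y : (F →+* ℝ) → ℝ) (x : F) :
    cexp (2 * Real.pi * I * pairing (x ^ 2) (fun σ ↦ (((4 * y σ)⁻¹ : ℝ) : ℂ) * I)) =
      ((thetaSummand F (fun w ↦ (2 * y (e w))⁻¹) x : ℝ) : ℂ) := by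
  rw [tii_cexp_pairing_mul_I, thetaSummand, tii_minkowskiQuadForm_eq F e he]
  congr 2
  simp only [Equiv.apply_symm_apply, map_pow, neg_mul, Finset.mul_sum, ← Finset.sum_neg_distrib]
  exact Finset.sum_congr rfl fun σ _ ↦ by ring

/-- At `z = iy`: `e^{2πi S(ξ² z)} = e^{-π ∑_σ (2y_σ) σ(ξ)²}`, the theta summand at height `2y`.
[folklore] -/
theorem tii_summand_rhs (y : (F →+* ℝ) → ℝ) (ξ : F) :
    cexp (2 * Real.pi * I * pairing (ξ ^ 2) (fun σ ↦ ((y σ : ℝ) : ℂ) * I)) =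
      ((thetaSummand F (fun w ↦ 2 * y (e w)) ξ : ℝ) : ℂ) := by
  rw [tii_cexp_pairing_mul_I, thetaSummand, tii_minkowskiQuadForm_eq F e he]
  congr 2
  simp only [Equiv.apply_symm_apply, map_pow, neg_mul, Finset.mul_sum, ← Finset.sum_neg_distrib]
  exact Finset.sum_congr rfl fun σ _ ↦ by ring

/-- `Θ(i/(4y)) = θ_𝓞(i (2y)⁻¹)`. [folklore] -/
theorem tii_lhs_eq (y : (F →+* ℝ) → ℝ) :
    (∑' x : 𝓞 F, cexp (2 * Real.pi * I * pairing (((x : 𝓞 F) : F) ^ 2)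
      (fun σ ↦ (((4 * y σ)⁻¹ : ℝ) : ℂ) * I))) =
      ((thetaIdeal F 1 (fun w ↦ (2 * y (e w))⁻¹) : ℝ) : ℂ) := by
  simp_rw [tii_summand_lhs F e he]
  obtain ⟨E, hE⟩ := tii_exists_intEquivOne F
  rw [← Complex.ofReal_tsum, thetaIdeal, ← E.tsum_eq]
  simp_rw [hE]

/-- `Θ'(iy) = θ_{𝔡⁻¹}(i 2y)`. [folklore] -/
theorem tii_rhs_eq (y : (F →+* ℝ) → ℝ) :
    (∑' ξ : {ν : F | ∀ a : 𝓞 F, ∃ n : ℤ, Algebra.trace ℚ F (ν * a) = n},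
        cexp (2 * Real.pi * I * pairing ((ξ : F) ^ 2) (fun σ ↦ ((y σ : ℝ) : ℂ) * I))) =
      ((thetaIdeal F (FractionalIdeal.dual ℤ ℚ 1) (fun w ↦ 2 * y (e w)) : ℝ) : ℂ) := by
  simp_rw [tii_summand_rhs F e he]
  obtain ⟨E, hE⟩ := tii_exists_dualEquiv F
  rw [← Complex.ofReal_tsum, thetaIdeal, ← E.tsum_eq]
  simp_rw [hE]

omit he in
/-- The constant: `√N(2y) / (𝔑(1) √|d_F|) = |d_F|^{-1/2} ∏_σ √(2 y_σ)`. [folklore] -/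
theorem tii_const_eq (y : (F →+* ℝ) → ℝ) (hy : ∀ σ, 0 < y σ) :
    Real.sqrt (mixedNorm F (fun w ↦ 2 * y (e w))) /
        ((FractionalIdeal.absNorm (1 : FractionalIdeal (𝓞 F)⁰ F) : ℝ) *
          Real.sqrt |(discr F : ℝ)|) =
      |(discr F : ℝ)| ^ (-(1 / 2 : ℝ)) * ∏ σ : F →+* ℝ, Real.sqrt (2 * y σ) := by
  have hN : mixedNorm F (fun w ↦ 2 * y (e w)) = ∏ σ : F →+* ℝ, 2 * y σ := by
    rw [tii_mixedNorm_eq F e]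
    simp only [Equiv.apply_symm_apply]
  have hsqrt : Real.sqrt (∏ σ : F →+* ℝ, 2 * y σ) = ∏ σ : F →+* ℝ, Real.sqrt (2 * y σ) := by
    rw [Real.sqrt_eq_rpow, ← Real.finsetProd_rpow Finset.univ (fun σ ↦ 2 * y σ)
      (fun σ _ ↦ by have := hy σ; positivity) (1 / 2)]
    exact Finset.prod_congr rfl fun σ _ ↦ (Real.sqrt_eq_rpow _).symm
  have hd : |(discr F : ℝ)| ^ (-(1 / 2 : ℝ)) = (Real.sqrt |(discr F : ℝ)|)⁻¹ := by
    rw [Real.rpow_neg (abs_nonneg _), ← Real.sqrt_eq_rpow]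
  rw [hN, hsqrt, hd, map_one, Rat.cast_one, one_mul, div_eq_mul_inv, mul_comm]

end Sides

/-- **stub V3 — `stub_theta_inversion_imaginary` (L; Hecke's theta transformation on the imaginary orthant, from the tree).**
For `y ≫ 0`: `Θ(i/(4y)) = |d_F|^{-1/2} ∏_σ √(2y_σ) · Θ'(iy)` — this is `thetaIdeal_inv_holds F` (Neukirch VII (3.6) with (5.7):
`θ_𝓞(y'⁻¹) = √N(y')/√|d_F| θ_{𝔡⁻¹}(y')`) at `y' = 2y`, after identifying `Θ(iy) = θ_𝓞(2y)` and `Θ'(iy) = θ_{𝔡⁻¹}(2y)` (real embeddings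
↔ real places of the totally real `F`; `(1 : FractionalIdeal) ↔ 𝓞F`, `FractionalIdeal.dual ℤ ℚ 1 ↔ 𝔡⁻¹`). [cite: NeukirchANT1999, Ch. VII (3.6), (5.7)] -/
theorem stub_theta_inversion_imaginary (F : Type) [Field F] [NumberField F] [NumberField.IsTotallyReal F]
    (y : (F →+* ℝ) → ℝ) (hy : ∀ σ, 0 < y σ) :
    (∑' x : 𝓞 F, cexp (2 * Real.pi * I * pairing (((x : 𝓞 F) : F) ^ 2) (fun σ ↦ (((4 * y σ)⁻¹ : ℝ) : ℂ) * I))) =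
      ((|(NumberField.discr F : ℝ)| ^ (-(1 / 2 : ℝ)) : ℝ) : ℂ) * (∏ σ : F →+* ℝ, ((Real.sqrt (2 * y σ) : ℝ) : ℂ)) *
        ∑' ξ : {ν : F | ∀ a : 𝓞 F, ∃ n : ℤ, Algebra.trace ℚ F (ν * a) = n},
          cexp (2 * Real.pi * I * pairing ((ξ : F) ^ 2) (fun σ ↦ ((y σ : ℝ) : ℂ) * I)) := by
  obtain ⟨e, he⟩ := tii_exists_embEquiv F
  have hH : ∀ w, 0 < 2 * y (e w) := fun w ↦ by
    have := hy (e w)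
    positivity
  have key := thetaIdeal_inv_holds F 1 one_ne_zero (fun w ↦ 2 * y (e w)) hH
  beta_reduce at key
  rw [tii_lhs_eq F e he, tii_rhs_eq F e he, key, tii_const_eq F e y hy]
  push_cast
  ring

end Summit.Langlands.Langlands.Theorems.HilbertIntegralOverconvergentIsCongruence

end
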